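import Summits.NavierStokesRegularity.NavierStokesRegularity.Theses.PumpContinuation
import Summits.NavierStokesRegularity.NavierStokesRegularity.Theorems.PerpetualPumpEulerTypeIGlue
import Literature.Analysis.FluidPDE.TaoCascadeProjection
import Literature.Analysis.FluidPDE.TaoCascadeWaveletData

/-!
# Route PumpContinuation · crux `EulerProximatePump` — stub `stub_scalingTools` (line `SketchIdeator2`)

Scaling covariance of Tao's mild formulation (2016, (1.15)): `IsMildSolutionFor T u₀ I u` says that
`u : I → H¹⁰_df(ℝ³)` is `H¹⁰`-continuous and
`⟨u t, w⟩ = ⟨e^{tΔ} u₀, w⟩ + ∫₀ᵗ ⟨T(u s, u s), e^{(t-s)Δ} w⟩ ds` for every `w ∈ H¹⁰_df`.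

* (i) `isMildSolutionFor_smul`: if `T'` is a trilinear form with `T'(c a, c b, w) = c · T(a, b, w)`
  (`c` real), then `u ↦ c u` maps `T`-mild solutions from `u₀` to `T'`-mild solutions from `c u₀` on the
  same time set: multiply the identity by `c` (`pairing_smul_left`, `heat_const_smul`,
  `intervalIntegral.integral_const_mul`); `H¹⁰_df` is a real subspace (`MemH10df.smul`) and
  `‖c x‖_{H¹⁰} = |c| ‖x‖_{H¹⁰}` (`eFourierSobolevNorm_const_smul`) gives the continuity.
* (ii) `typeIBlowup_smul`: for `c > 0`, a Schwartz-data mild Type-I blow-up of `T` at ceiling `M` with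
  no mild extension is carried to one of `T'` at ceiling `c M` (datum `c u₀`, `schwartzL2_smul`; same
  blow-up time; the rate by `eLpNorm_coe_const_smul`; an extension of `c u` for `T'` rescales back by
  `c⁻¹`, part (i) again, to an extension of `u` for `T`).

The file ends with the registered Tools stub `stub_scalingTools` as the conjunction of (i) and (ii).

## References

* T. Tao, J. Amer. Math. Soc. 29 (2016), arXiv:1402.0290v3, §1.1 (1.15). [Tao2016AveragedNS]
-/

noncomputable section

-- the nested summit namespace `…NavierStokesRegularity.NavierStokesRegularity…` is the tree's layout (D-0017)
set_option linter.dupNamespace false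

open MeasureTheory Set Filter Topology
open scoped ENNReal
open Literature.Analysis.FluidPDE Literature.Analysis.FluidPDE.Tao2016

namespace Summit.NavierStokesRegularity.NavierStokesRegularity.Theorems.PumpContinuationEulerProximatePump

open Literature.Analysis.FunctionSpaces (eFourierSobolevNorm)
open PerpetualPumpEulerTypeIGlue (heat_const_smul eFourierSobolevNorm_const_smul
  eLpNorm_coe_const_smul isDivFree_const_smul)

/-! ### (i) Scaling covariance of mild solutions -/

/-- **Scaling covariance of Tao's mild formulation.** If `u` is an `H¹⁰_df`-mild solution of
`∂ₜu = Δu + T(u,u)` from `u₀` on `I`, and `T'(c a, c b, w) = c · T(a, b, w)` for a real scalar `c`,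
then `t ↦ c • u t` is an `H¹⁰_df`-mild solution of `∂ₜu = Δu + T'(u,u)` from `c • u₀` on `I`
(linearity of `e^{τΔ}` and of the pairing; `H¹⁰_df` is a real subspace). [cite: Tao2016AveragedNS, §1.1 (1.15)] -/
theorem isMildSolutionFor_smul (T T' : L2C → L2C → L2C → ℂ) (c : ℝ)
    (hT : ∀ a b w : L2C, T' (((c : ℝ) : ℂ) • a) (((c : ℝ) : ℂ) • b) w = ((c : ℝ) : ℂ) * T a b w)
    (u₀ : L2C) (I : Set ℝ) (u : ℝ → L2C) (hu : IsMildSolutionFor T u₀ I u) :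
    IsMildSolutionFor T' (((c : ℝ) : ℂ) • u₀) I (fun t => ((c : ℝ) : ℂ) • u t) := by
  obtain ⟨hH, hc, hid⟩ := hu
  refine ⟨fun t ht => (hH t ht).smul c, ?_, fun t ht w hw => ?_⟩
  · -- continuity in `H¹⁰` on `I`
    intro t₀ ht₀
    show Tendsto (fun t => eFourierSobolevNorm 10
        (((c : ℝ) : ℂ) • u t - ((c : ℝ) : ℂ) • u t₀)) (𝓝[I] t₀) (𝓝 0)
    have h2 : Tendsto (fun t => ‖((c : ℝ) : ℂ)‖ₑ * eFourierSobolevNorm 10 (u t - u t₀)) (𝓝[I] t₀)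
        (𝓝 (‖((c : ℝ) : ℂ)‖ₑ * 0)) :=
      ENNReal.Tendsto.const_mul (hc t₀ ht₀) (Or.inr enorm_ne_top)
    rw [mul_zero] at h2
    refine h2.congr fun t => ?_
    rw [← smul_sub, eFourierSobolevNorm_const_smul]
  · -- the mild identity, multiplied by `c`
    show pairing (((c : ℝ) : ℂ) • u t) w = pairing (heat t (((c : ℝ) : ℂ) • u₀)) w +
        ∫ s in (0:ℝ)..t, T' (((c : ℝ) : ℂ) • u s) (((c : ℝ) : ℂ) • u s) (heat (t - s) w)
    have h1 : (∫ s in (0:ℝ)..t, T' (((c : ℝ) : ℂ) • u s) (((c : ℝ) : ℂ) • u s) (heat (t - s) w)) =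
        ((c : ℝ) : ℂ) * ∫ s in (0:ℝ)..t, T (u s) (u s) (heat (t - s) w) := by
      rw [← intervalIntegral.integral_const_mul]
      exact intervalIntegral.integral_congr fun s _ => hT _ _ _
    rw [h1, heat_const_smul, pairing_smul_left, pairing_smul_left, hid t ht w hw]
    ring

/-! ### (ii) Scaling of Schwartz-data mild Type-I blow-ups with no extension -/

/-- For `c > 0` and the trilinear forms of (i): inverting the scaling, `T(c⁻¹ a, c⁻¹ b, w) =
c⁻¹ · T'(a, b, w)`. [folklore] -/
theorem smul_inv_of_smul (T T' : L2C → L2C → L2C → ℂ) {c : ℝ} (hc : c ≠ 0)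
    (hT : ∀ a b w : L2C, T' (((c : ℝ) : ℂ) • a) (((c : ℝ) : ℂ) • b) w = ((c : ℝ) : ℂ) * T a b w)
    (a b w : L2C) :
    T (((c⁻¹ : ℝ) : ℂ) • a) (((c⁻¹ : ℝ) : ℂ) • b) w = ((c⁻¹ : ℝ) : ℂ) * T' a b w := by
  have h1 := hT (((c⁻¹ : ℝ) : ℂ) • a) (((c⁻¹ : ℝ) : ℂ) • b) w
  rw [smul_smul, smul_smul, ← Complex.ofReal_mul, mul_inv_cancel₀ hc, Complex.ofReal_one,
    one_smul, one_smul] at h1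
  rw [h1, ← mul_assoc, ← Complex.ofReal_mul, inv_mul_cancel₀ hc, Complex.ofReal_one, one_mul]

/-- `c⁻¹ • (c • x) = x` with the real-to-complex casts. [folklore] -/
theorem inv_smul_smul_ofReal {c : ℝ} (hc : c ≠ 0) (x : L2C) :
    ((c⁻¹ : ℝ) : ℂ) • ((c : ℝ) : ℂ) • x = x := by
  rw [smul_smul, ← Complex.ofReal_mul, inv_mul_cancel₀ hc, Complex.ofReal_one, one_smul]

/-- **Scaling of a mild Type-I blow-up with no extension.** For `c > 0` and `T'(c a, c b, w) =
c · T(a, b, w)`: a Schwartz divergence-free datum `u₀`, a time `S > 0` and a `T`-mild solution `u`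
on `[0,S)` from `schwartzL2 u₀` with `‖u t‖_∞ ≤ M/√(S-t)` and no `T`-mild extension past `S` yield the
same for `T'` at ceiling `c M`: datum `c • u₀`, curve `c • u`, and an extension of `c • u` for `T'`
would rescale by `c⁻¹` to an extension of `u` for `T`. [cite: Tao2016AveragedNS, §1.1 (1.15)] -/
theorem typeIBlowup_smul (T T' : L2C → L2C → L2C → ℂ) (c : ℝ) (hc : 0 < c)
    (hT : ∀ a b w : L2C, T' (((c : ℝ) : ℂ) • a) (((c : ℝ) : ℂ) • b) w = ((c : ℝ) : ℂ) * T a b w)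
    (M : ℝ)
    (h : ∃ u₀ : SchwartzMap (EuclideanSpace ℝ (Fin 3)) (EuclideanSpace ℝ (Fin 3)),
      VectorCalculus.IsDivFree ⇑u₀ ∧ ∃ S : ℝ, 0 < S ∧ ∃ u : ℝ → L2C,
        IsMildSolutionFor T (schwartzL2 u₀) (Ico 0 S) u ∧
        (∀ t ∈ Ico 0 S, eLpNorm (u t) ⊤ volume ≤ ENNReal.ofReal (M / Real.sqrt (S - t))) ∧
        ¬ ∃ S' : ℝ, S < S' ∧ ∃ v : ℝ → L2C,
            IsMildSolutionFor T (schwartzL2 u₀) (Ico 0 S') v ∧ ∀ t ∈ Ico 0 S, v t = u t) :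
    ∃ u₀ : SchwartzMap (EuclideanSpace ℝ (Fin 3)) (EuclideanSpace ℝ (Fin 3)),
      VectorCalculus.IsDivFree ⇑u₀ ∧ ∃ S : ℝ, 0 < S ∧ ∃ u : ℝ → L2C,
        IsMildSolutionFor T' (schwartzL2 u₀) (Ico 0 S) u ∧
        (∀ t ∈ Ico 0 S, eLpNorm (u t) ⊤ volume ≤ ENNReal.ofReal (c * M / Real.sqrt (S - t))) ∧
        ¬ ∃ S' : ℝ, S < S' ∧ ∃ v : ℝ → L2C,
            IsMildSolutionFor T' (schwartzL2 u₀) (Ico 0 S') v ∧ ∀ t ∈ Ico 0 S, v t = u t := by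
  obtain ⟨u₀, hdiv, S, hS, u, hu, hrate, hnoext⟩ := h
  have hc0 : c ≠ 0 := hc.ne'
  refine ⟨c • u₀, ?_, S, hS, fun t => ((c : ℝ) : ℂ) • u t, ?_, ?_, ?_⟩
  · -- the scaled datum is divergence free
    exact isDivFree_const_smul (u₀.smooth 1) hdiv c
  · -- `c • u` is `T'`-mild from `schwartzL2 (c • u₀) = c • schwartzL2 u₀`
    rw [schwartzL2_smul]
    exact isMildSolutionFor_smul T T' c hT _ _ _ hu
  · -- the Type-I rate at ceiling `c M`
    intro t ht
    have hcn : ‖((c : ℝ) : ℂ)‖ₑ = ENNReal.ofReal c := by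
      rw [← ofReal_norm, Complex.norm_real, Real.norm_eq_abs, abs_of_nonneg hc.le]
    show eLpNorm (((((c : ℝ) : ℂ) • u t : L2C)) : EuclideanSpace ℝ (Fin 3) → EuclideanSpace ℂ (Fin 3))
        ⊤ volume ≤ ENNReal.ofReal (c * M / Real.sqrt (S - t))
    rw [eLpNorm_coe_const_smul, hcn]
    calc ENNReal.ofReal c * eLpNorm (u t : EuclideanSpace ℝ (Fin 3) → EuclideanSpace ℂ (Fin 3)) ⊤ volume
        ≤ ENNReal.ofReal c * ENNReal.ofReal (M / Real.sqrt (S - t)) :=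
          mul_le_mul_right (hrate t ht) _
      _ = ENNReal.ofReal (c * M / Real.sqrt (S - t)) := by
          rw [← ENNReal.ofReal_mul hc.le, mul_div_assoc]
  · -- no `T'`-mild extension of `c • u`: rescale one back by `c⁻¹`
    rintro ⟨S', hSS', v, hv, hvu⟩
    refine hnoext ⟨S', hSS', fun t => ((c⁻¹ : ℝ) : ℂ) • v t, ?_, fun t ht => ?_⟩
    · have h2 := isMildSolutionFor_smul T' T c⁻¹ (smul_inv_of_smul T T' hc0 hT) _ _ _ hv
      rwa [schwartzL2_smul, inv_smul_smul_ofReal hc0] at h2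
    · show ((c⁻¹ : ℝ) : ℂ) • v t = u t
      have h3 : v t = ((c : ℝ) : ℂ) • u t := hvu t ht
      rw [h3, inv_smul_smul_ofReal hc0]

/-! ### The registered Tools stub -/

/-- **Stub (tools: scaling covariance of Tao's mild formulation).** (i) If `u` is an `H¹⁰_df`-mild solution of
`∂ₜu = Δu + T(u,u)` from `u₀` on `I` and `T'` is a trilinear form with `T'(c a, c b, w) = c · T(a, b, w)` (`c` real),
then `c u` is an `H¹⁰_df`-mild solution of `∂ₜu = Δu + T'(u,u)` from `c u₀` on `I` (linearity of `e^{τΔ}` and of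
the pairing, `H¹⁰_df` a real subspace). (ii) Consequently, for `c > 0`, a Schwartz-data mild Type-I blow-up of
`T` at ceiling `M` with no mild extension is carried to one of `T'` at ceiling `c M` (datum `c u₀`, same blow-up
time; an extension of `c u` for `T'` would rescale back by `c⁻¹` to an extension of `u` for `T`). [cite: Tao2016AveragedNS, §1.1 (1.15)] -/
theorem stub_scalingTools :
    (∀ (T T' : L2C → L2C → L2C → ℂ) (c : ℝ),
      (∀ a b w : L2C, T' (((c : ℝ) : ℂ) • a) (((c : ℝ) : ℂ) • b) w = ((c : ℝ) : ℂ) * T a b w) →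
      ∀ (u₀ : L2C) (I : Set ℝ) (u : ℝ → L2C), IsMildSolutionFor T u₀ I u →
        IsMildSolutionFor T' (((c : ℝ) : ℂ) • u₀) I (fun t => ((c : ℝ) : ℂ) • u t)) ∧
    (∀ (T T' : L2C → L2C → L2C → ℂ) (c : ℝ), 0 < c →
      (∀ a b w : L2C, T' (((c : ℝ) : ℂ) • a) (((c : ℝ) : ℂ) • b) w = ((c : ℝ) : ℂ) * T a b w) →
      ∀ M : ℝ,
        (∃ u₀ : SchwartzMap (EuclideanSpace ℝ (Fin 3)) (EuclideanSpace ℝ (Fin 3)),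
          VectorCalculus.IsDivFree ⇑u₀ ∧ ∃ S : ℝ, 0 < S ∧ ∃ u : ℝ → L2C,
            IsMildSolutionFor T (schwartzL2 u₀) (Ico 0 S) u ∧
            (∀ t ∈ Ico 0 S, eLpNorm (u t) ⊤ volume ≤ ENNReal.ofReal (M / Real.sqrt (S - t))) ∧
            ¬ ∃ S' : ℝ, S < S' ∧ ∃ v : ℝ → L2C,
                IsMildSolutionFor T (schwartzL2 u₀) (Ico 0 S') v ∧ ∀ t ∈ Ico 0 S, v t = u t) →
        ∃ u₀ : SchwartzMap (EuclideanSpace ℝ (Fin 3)) (EuclideanSpace ℝ (Fin 3)),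
          VectorCalculus.IsDivFree ⇑u₀ ∧ ∃ S : ℝ, 0 < S ∧ ∃ u : ℝ → L2C,
            IsMildSolutionFor T' (schwartzL2 u₀) (Ico 0 S) u ∧
            (∀ t ∈ Ico 0 S, eLpNorm (u t) ⊤ volume ≤ ENNReal.ofReal (c * M / Real.sqrt (S - t))) ∧
            ¬ ∃ S' : ℝ, S < S' ∧ ∃ v : ℝ → L2C,
                IsMildSolutionFor T' (schwartzL2 u₀) (Ico 0 S') v ∧ ∀ t ∈ Ico 0 S, v t = u t) :=
  ⟨isMildSolutionFor_smul, typeIBlowup_smul⟩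

end Summit.NavierStokesRegularity.NavierStokesRegularity.Theorems.PumpContinuationEulerProximatePump

end
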